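import Mathlib
import HarnessLib
import Summits.HubbardSuperconductivity.HubbardSuperconductivity.Theorems.KLProgrammeKLRegimeThinMultiplierIncrementPairTangent
import Summits.HubbardSuperconductivity.HubbardSuperconductivity.Theorems.KLProgrammeKLRegimeThinMultiplierIncrementPairScaleIso
import Summits.HubbardSuperconductivity.HubbardSuperconductivity.Theorems.KLProgrammeKLRegimeFatMultiplierIncrementPairScaleTan

/-!
# K3 VL child `KLRegimeVolumeLimitV17F2` (stmt-HubbardSuperconductivity-20440), located item #23 «W2-HALF-VL», brick «W2H-OVL» part 11 (SCALE, tangent): the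
# THIN increment pair along the sector's TANGENT step — space differences with the ANISOTROPIC slot in RELATIVE SCALE FORM

Cell `gate-hubbard-kl`, seat p3 (g14), lead of #23; THIN twin of k3c3-p2's `…FatMultiplierIncrementPairScaleTan` (p595305):
`norm_fwdDiff_iter_tangent_thinIncrPair_le` (T3, slot `τ₀ + K₂√2ρ‖toLp w‖`) with the cell of the co-factor's sector `(n_b, ω_b)` at the co-factor's shell
`Λ_b` (`frameBand_cell` + `angularFactor_support`; radius `ρ_f = (Λ_b + s_max·Dt_min·(3w_{n_b}/4))/(Dt_min − 2A)`), tangency `|De_K(p_F)·w| ≤ |2π/L|·T₀`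
at `p_F = klFermiPoint μ K θ_{n_b,ω_b}` (FREE `T₀ ≥ 0`: `4+2A` for the base term by `tangentStep_bounds`, transported for the other term), step of
Euclidean length `η ≥ (2π/L)(N_r − 1)` ⇒ slot `≤ t·η`, `t = T₀/(N_r−1) + K₂√2ρ_f`; then `thinIncr_cofactor_scale_le` ∘ `incrPair_space_rel_scale_le`:

* **`norm_fwdDiff_iter_thinIncrPair_scaleTan_le`** — `‖Δ_u^k Gs^Δ(q)‖ ≤ 𝔅₀(x)·η^k·(r̃_{k0} + … + r̃_{kk}x^k)`, `k = 1,2,3` (the packager uses `k = 2, 3` along `v`).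

Everything is proved; no definitions, no sorry.  Nothing asserts any stub, K3, VL or superconductivity.
[cite: BenfattoGiulianiMastropietro2006, §2.5 Lemma 2.2 (2.53)–(2.55), §2.7 (2.69)–(2.71a), §3 (3.2)–(3.8)]
-/

noncomputable section

namespace Summit.HubbardSuperconductivity.HubbardSuperconductivity.Theorems.TorusFourierL2

set_option linter.dupNamespace false -- summit = problem name (single-conjunct summit), D-0017

open Set Finset Filter Topology Literature.MathematicalPhysics.QuantumLattice Literature.MathematicalPhysics.QuantumLattice.BandSectorCounting
open Literature.MathematicalPhysics.QuantumLattice.FermiRG Literature.Probability.LatticeModels Literature.Analysis.SpecialFunctions Literature.Analysis.Calculus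
open Summit.HubbardSuperconductivity.HubbardSuperconductivity.Theorems.DispersionFlow
open Summit.HubbardSuperconductivity.HubbardSuperconductivity.Theorems.KLRegimeSplit
open Summit.HubbardSuperconductivity.HubbardSuperconductivity.Theorems.KLProgrammeLegKernels
open Summit.HubbardSuperconductivity.HubbardSuperconductivity.Theorems.PerturbedFermiCurve
open scoped Real Nat

section ThinTanScale

open Classical

variable {L M : ℕ} [NeZero L] [NeZero M] {a b : ℝ} (B : BandBounds a b) {K : TrigPolyC4v} (Ko : TrigPolyC4v) {A A₃ : ℝ}
  (hA : ∀ p : Momentum, ∀ j ≤ 2, ‖iteratedFDeriv ℝ j (frameShift K) p‖ ≤ A) (hA3 : ∀ p : Momentum, ‖iteratedFDeriv ℝ 3 (frameShift K) p‖ ≤ A₃)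
  (hADt : 2 * A < B.Dtmin)
  {μ e₀ z β : ℝ} (he : 0 < e₀) (hz : 0 < z) (hz1 : z ≤ 1) (hgap : e₀ + A + z ^ 2 < -μ) (h3 : e₀ + A - μ ≤ 3)
  (hlo : a ≤ μ - A - e₀) (hhi : μ + A + e₀ ≤ b)
  (na nb : ℕ) {K₂ : ℝ} (hK₂ : ∀ p, ‖iteratedFDeriv ℝ 2 (frameLevel μ K) p‖ ≤ K₂)
  {Nr T₀ : ℝ} (hNr : 2 ≤ Nr) (hLz : 3 * |2 * π / L| * (Nr + 1 / 2) ≤ z) (hT₀ : 0 ≤ T₀)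
  {d : ℝ} (hd1 : ∀ u, |deriv (bgmCutoffSq e₀) u| ≤ d) (hd2 : ∀ u, |iteratedDeriv 2 (bgmCutoffSq e₀) u| ≤ d)
  (hd3 : ∀ u, |iteratedDeriv 3 (bgmCutoffSq e₀) u| ≤ d) (hd4 : ∀ u, |iteratedDeriv 4 (bgmCutoffSq e₀) u| ≤ d)
  {Ba : ℝ} (hB0 : 0 ≤ Ba)
  (hB : ∀ (i : ℕ), i ≤ 3 → ∀ (n : ℕ) (ω : ℤ) (θ₀ : ℝ) (q w : Fin 2 → ℝ) (t : ℝ) {r₀ : ℝ}, 0 < r₀ →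
    r₀ ≤ ‖momToComplex (q + t • w)‖ → |sectorRelAngle θ₀ (q + t • w)| < π →
    ‖iteratedDeriv i (fun t : ℝ => sectorWeightCirc n ω (polarAngle (q + t • w))) t‖ ≤
      (3 : ℕ)! * Ba * ((1 + (sectorWidth n)⁻¹ * (3 : ℕ)!) * ‖momToComplex w‖ / r₀) ^ i)
  -- the piece `ν = e_K − e_{K_o}` in the two-scale class at depth `x`
  {ν : (Fin 2 → ℝ) → ℝ} (hν : ∀ p, ν p = frameLevel μ K (WithLp.toLp 2 p) - frameLevel μ Ko (WithLp.toLp 2 p)) (hνs : ContDiff ℝ 3 ν)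
  {x G₀ G₁ G₂ G₃ ε₃₀ ε₃₁ : ℝ} (hx : 1 ≤ x) (hG₀ : 0 < G₀) (hG₁ : 0 ≤ G₁) (hG₂ : 0 ≤ G₂) (hG₃ : 0 ≤ G₃) (hε₃₀ : 0 ≤ ε₃₀) (hε₃₁ : 0 ≤ ε₃₁)
  (hN₀ : ∀ p, |ν p| ≤ G₀ / x ^ 2) (hN₁ : ∀ p, ‖fderiv ℝ ν p‖ ≤ G₁ / x) (hN₂ : ∀ p, ‖iteratedFDeriv ℝ 2 ν p‖ ≤ G₂)
  (hN₃ : ∀ p, ‖iteratedFDeriv ℝ 3 ν p‖ ≤ G₃ * x) (hGΛ : G₀ / x ^ 2 ≤ klScale e₀ na) (hA₃x : 4 + 8 * A₃ ≤ ε₃₀ + ε₃₁ * x)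
  -- the names (instantiate with `rfl`)
  {ρf κ C₁ B₀x t ε₂ ζ 𝔮₁ 𝔮₂ 𝔮₃₀ 𝔮₃₁ d₁ w₁ d₂ w₂ d₃₀ d₃₁ w₃₀ w₃₁ o₁₀ o₁₁ o₂₀ o₂₁ o₂₂ o₃₀ o₃₁ o₃₂ o₃₃
    R₁₀ R₁₁ R₂₀ R₂₁ R₂₂ R₃₀ R₃₁ R₃₂ R₃₃ r₁₀ r₁₁ r₂₀ r₂₁ r₂₂ r₃₀ r₃₁ r₃₂ r₃₃ : ℝ}
  (hρf : ρf = (klScale e₀ nb + B.smax * B.Dtmin * (3 * sectorWidth nb / 4)) / (B.Dtmin - 2 * A))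
  (hκ : κ = e₀ ^ 2 / klScale e₀ na ^ 2) (hC₁ : C₁ = d * e₀ ^ 2 / klScale e₀ na ^ 2)
  (hB₀x : B₀x = C₁ * (G₀ / x ^ 2 * (2 * (klScale e₀ na + G₀ / x ^ 2) + G₀ / x ^ 2)))
  (ht : t = T₀ / (Nr - 1) + K₂ * (Real.sqrt 2 * ρf)) (hε₂ : ε₂ = 4 + 4 * A) (hζ : ζ = (1 + 6 * (sectorWidth na)⁻¹) + (1 + 6 * (sectorWidth nb)⁻¹))
  (h𝔮₁ : 𝔮₁ = 2 * (d * e₀ ^ 2) * t / klScale e₀ nb + 1 * (12 * Ba * ζ))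
  (h𝔮₂ : 𝔮₂ = (4 * (d * e₀ ^ 4) + 2 * (d * e₀ ^ 2)) * t ^ 2 / klScale e₀ nb ^ 2 + 2 * (d * e₀ ^ 2) * (4 + 4 * A) / klScale e₀ nb +
    4 * (d * e₀ ^ 2) * t / klScale e₀ nb * (1 * (12 * Ba * ζ)) + 1 * ((12 * Ba + 72 * Ba ^ 2) * ζ ^ 2))
  (h𝔮₃₀ : 𝔮₃₀ = (8 * (d * e₀ ^ 6) + 12 * (d * e₀ ^ 4)) * t ^ 3 / klScale e₀ nb ^ 3 + (12 * (d * e₀ ^ 4) + 6 * (d * e₀ ^ 2)) * (t * (4 + 4 * A)) / klScale e₀ nb ^ 2 +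
    2 * (d * e₀ ^ 2) * ε₃₀ / klScale e₀ nb +
    3 * (((4 * (d * e₀ ^ 4) + 2 * (d * e₀ ^ 2)) * t ^ 2 / klScale e₀ nb ^ 2 + 2 * (d * e₀ ^ 2) * (4 + 4 * A) / klScale e₀ nb) * (1 * (12 * Ba * ζ))) +
    3 * (2 * (d * e₀ ^ 2) * t / klScale e₀ nb * (1 * ((12 * Ba + 72 * Ba ^ 2) * ζ ^ 2))) + 1 * ((12 * Ba + 216 * Ba ^ 2) * ζ ^ 3))
  (h𝔮₃₁ : 𝔮₃₁ = 2 * (d * e₀ ^ 2) * ε₃₁ / klScale e₀ nb)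
  (hd₁ : d₁ = 4 * klScale e₀ na * t) (hw₁ : w₁ = 2 * (t * G₀ + 2 * klScale e₀ na * G₁ + G₀ * G₁)) (hd₂ : d₂ = 2 * (t ^ 2 + 2 * klScale e₀ na * ε₂))
  (hw₂ : w₂ = 2 * (ε₂ * G₀ + 2 * t * G₁ + 2 * klScale e₀ na * G₂ + G₁ ^ 2 + G₀ * G₂))
  (hd₃₀ : d₃₀ = 2 * (3 * t * ε₂ + 2 * klScale e₀ na * ε₃₀)) (hd₃₁ : d₃₁ = 4 * klScale e₀ na * ε₃₁)
  (hw₃₀ : w₃₀ = 2 * (ε₃₀ * G₀ + ε₃₁ * G₀ + 3 * ε₂ * G₁ + 3 * t * G₂ + 3 * G₁ * G₂ + G₀ * G₃)) (hw₃₁ : w₃₁ = 4 * klScale e₀ na * G₃)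
  (ho₁₀ : o₁₀ = t / klScale e₀ na) (ho₁₁ : o₁₁ = 2 * G₁ / G₀) (ho₂₀ : o₂₀ = ε₂ / klScale e₀ na + G₁ ^ 2 / (klScale e₀ na * G₀))
  (ho₂₁ : o₂₁ = 2 * t * G₁ / (klScale e₀ na * G₀)) (ho₂₂ : o₂₂ = 2 * G₂ / G₀)
  (ho₃₀ : o₃₀ = ε₃₀ / klScale e₀ na) (ho₃₁ : o₃₁ = ε₃₁ / klScale e₀ na + 3 * ε₂ * G₁ / (klScale e₀ na * G₀) + 3 * G₁ * G₂ / (klScale e₀ na * G₀))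
  (ho₃₂ : o₃₂ = 3 * t * G₂ / (klScale e₀ na * G₀)) (ho₃₃ : o₃₃ = 2 * G₃ / G₀)
  (hR₁₀ : R₁₀ = κ * (d₁ + w₁) + o₁₀) (hR₁₁ : R₁₁ = o₁₁)
  (hR₂₀ : R₂₀ = κ ^ 2 * (d₁ + w₁) ^ 2 + κ * (o₁₀ * (2 * d₁ + w₁)) + κ * (d₂ + w₂) + o₂₀) (hR₂₁ : R₂₁ = κ * (o₁₁ * (2 * d₁ + w₁)) + o₂₁)
  (hR₂₂ : R₂₂ = o₂₂)
  (hR₃₀ : R₃₀ = κ ^ 3 * (d₁ + w₁) ^ 3 + κ ^ 2 * (o₁₀ * (3 * d₁ ^ 2 + 3 * d₁ * w₁ + w₁ ^ 2)) +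
    3 * (κ ^ 2 * ((d₁ + w₁) * (d₂ + w₂)) + κ * (d₁ * o₂₀ + o₁₀ * d₂ + o₁₀ * w₂)) + κ * (d₃₀ + w₃₀) + o₃₀)
  (hR₃₁ : R₃₁ = κ ^ 2 * (o₁₁ * (3 * d₁ ^ 2 + 3 * d₁ * w₁ + w₁ ^ 2)) + 3 * (κ * (d₁ * o₂₁ + o₁₁ * d₂ + o₁₁ * w₂)) + κ * (d₃₁ + w₃₁) + o₃₁)
  (hR₃₂ : R₃₂ = 3 * (κ * (d₁ * o₂₂)) + o₃₂) (hR₃₃ : R₃₃ = o₃₃)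
  (hr₁₀ : r₁₀ = R₁₀ + 𝔮₁) (hr₁₁ : r₁₁ = R₁₁) (hr₂₀ : r₂₀ = R₂₀ + 2 * R₁₀ * 𝔮₁ + 𝔮₂) (hr₂₁ : r₂₁ = R₂₁ + 2 * R₁₁ * 𝔮₁) (hr₂₂ : r₂₂ = R₂₂)
  (hr₃₀ : r₃₀ = R₃₀ + 3 * R₂₀ * 𝔮₁ + 3 * R₁₀ * 𝔮₂ + 𝔮₃₀) (hr₃₁ : r₃₁ = R₃₁ + 3 * R₂₁ * 𝔮₁ + 3 * R₁₁ * 𝔮₂ + 𝔮₃₁)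
  (hr₃₂ : r₃₂ = R₃₂ + 3 * R₂₂ * 𝔮₁) (hr₃₃ : r₃₃ = R₃₃)

include B hA hA3 hADt he hz hz1 hgap h3 hlo hhi hK₂ hNr hLz hT₀ hd1 hd2 hd3 hd4 hB0 hB hν hνs hx hG₀ hG₁ hG₂ hG₃ hε₃₀ hε₃₁ hN₀ hN₁ hN₂ hN₃ hGΛ hA₃x hρf hκ hC₁ hB₀x
  ht hε₂ hζ h𝔮₁ h𝔮₂ h𝔮₃₀ h𝔮₃₁
  hd₁ hw₁ hd₂ hw₂ hd₃₀ hd₃₁ hw₃₀ hw₃₁ ho₁₀ ho₁₁ ho₂₀ ho₂₁ ho₂₂ ho₃₀ ho₃₁ ho₃₂ ho₃₃ hR₁₀ hR₁₁ hR₂₀ hR₂₁ hR₂₂ hR₃₀ hR₃₁ hR₃₂ hR₃₃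
  hr₁₀ hr₁₁ hr₂₀ hr₂₁ hr₂₂ hr₃₀ hr₃₁ hr₃₂ hr₃₃ in
set_option maxHeartbeats 4000000 in
/-- **Space differences of the THIN increment pair along the tangent step, anisotropic slot, in relative scale form** (see the module docstring).
[cite: BenfattoGiulianiMastropietro2006, §2.5 Lemma 2.2 (2.53)–(2.55), §2.7 (2.69)–(2.71a), §3 (3.2)–(3.8)] -/
theorem norm_fwdDiff_iter_thinIncrPair_scaleTan_le (ωa : Fin (sectorCount na)) (ωb : Fin (sectorCount nb)) (Gs : TorusSite 1 (2 * M) × TorusSite 2 L → ℂ)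
    (hGsdef : Gs = fun q => klAnisoFamily L M β μ Ko e₀ na ωa (⟨(q.1 0).val, ZMod.val_lt (q.1 0)⟩, q.2) *
        klAnisoFamily L M β μ K e₀ nb ωb (⟨(q.1 0).val, ZMod.val_lt (q.1 0)⟩, q.2) -
      klAnisoFamily L M β μ K e₀ na ωa (⟨(q.1 0).val, ZMod.val_lt (q.1 0)⟩, q.2) *
        klAnisoFamily L M β μ K e₀ nb ωb (⟨(q.1 0).val, ZMod.val_lt (q.1 0)⟩, q.2))
    (u : Fin 2 → ℤ) (hvj : ∀ j, |(u j : ℝ)| ≤ Nr + 1 / 2) (hvlen : Nr - 1 ≤ Real.sqrt ((u 0 : ℝ) ^ 2 + (u 1 : ℝ) ^ 2))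
    (hvtan : |fderiv ℝ (fun p : Fin 2 → ℝ => frameLevel μ K (WithLp.toLp 2 p)) (klFermiPoint μ K (sectorCenter nb (ωb : ℕ)))
      (fun j => 2 * π / L * (u j : ℝ))| ≤ |2 * π / L| * T₀)
    (q : TorusSite 1 (2 * M) × TorusSite 2 L) :
    ‖(fwdDiff ((0 : TorusSite 1 (2 * M)), (fun j => ((u j : ℤ) : ZMod L)))) Gs q‖ ≤
        B₀x * (‖(WithLp.toLp 2 (fun j => 2 * π / L * (u j : ℝ)) : EuclideanSpace ℝ (Fin 2))‖ * (r₁₀ + r₁₁ * x)) ∧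
    ‖((fwdDiff ((0 : TorusSite 1 (2 * M)), (fun j => ((u j : ℤ) : ZMod L))))^[2] Gs) q‖ ≤
        B₀x * (‖(WithLp.toLp 2 (fun j => 2 * π / L * (u j : ℝ)) : EuclideanSpace ℝ (Fin 2))‖ ^ 2 * (r₂₀ + r₂₁ * x + r₂₂ * x ^ 2)) ∧
    ‖((fwdDiff ((0 : TorusSite 1 (2 * M)), (fun j => ((u j : ℤ) : ZMod L))))^[3] Gs) q‖ ≤
        B₀x * (‖(WithLp.toLp 2 (fun j => 2 * π / L * (u j : ℝ)) : EuclideanSpace ℝ (Fin 2))‖ ^ 3 * (r₃₀ + r₃₁ * x + r₃₂ * x ^ 2 + r₃₃ * x ^ 3)) ∧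
    (0 ≤ r₁₀ ∧ 0 ≤ r₁₁ ∧ 0 ≤ r₂₀ ∧ 0 ≤ r₂₁ ∧ 0 ≤ r₂₂ ∧ 0 ≤ r₃₀ ∧ 0 ≤ r₃₁ ∧ 0 ≤ r₃₂ ∧ 0 ≤ r₃₃) := by
  have hL : (0 : ℝ) < L := Nat.cast_pos.2 (Nat.pos_of_ne_zero (NeZero.ne L))
  have hπ := Real.pi_pos
  have hΛ : 0 < klScale e₀ na := by rw [klScale]; positivity
  have hΛb : 0 < klScale e₀ nb := by rw [klScale]; positivity
  have hA0 : 0 ≤ A := (norm_nonneg _).trans (hA 0 0 (by norm_num))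
  have hd0 : 0 ≤ d := (abs_nonneg _).trans (hd1 0)
  have hx0 : 0 < x := lt_of_lt_of_le one_pos hx
  have hK20 : 0 ≤ K₂ := (norm_nonneg _).trans (hK₂ 0)
  have hNr1 : 0 < Nr - 1 := by linarith only [hNr]
  have hDt : 0 < B.Dtmin - 2 * A := by linarith only [hADt]
  have hΛbe : klScale e₀ nb ≤ e₀ := klScale_le_e0 he.le nb
  have hρf0 : 0 ≤ ρf := by rw [hρf]; have := B.smax_pos; have := B.Dtmin_pos; have := sectorWidth_pos nb; positivity
  have hu : ∀ j, 3 * |2 * π / L| * |(u j : ℝ)| ≤ z := fun j => by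
    have h := mul_le_mul_of_nonneg_left (hvj j) (by positivity : (0:ℝ) ≤ 3 * |2 * π / L|)
    exact h.trans hLz
  -- the objects: angular factor, increment symbol, identification
  obtain ⟨Z, hZdef⟩ : ∃ Z : (Fin 2 → ℝ) → ℝ, Z = fun p => gnCutoff ((π + z) ^ 2 / π ^ 2) ((π + z) ^ 2) (p 0 ^ 2) * gnCutoff ((π + z) ^ 2 / π ^ 2) ((π + z) ^ 2) (p 1 ^ 2) *
    ((radialCutoffC (1 / 2) (momToComplex p) * sectorWeightCirc na ((ωa : ℕ) : ℤ) (polarAngle p)) *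
      (radialCutoffC (1 / 2) (momToComplex p) * sectorWeightCirc nb ((ωb : ℕ) : ℤ) (polarAngle p))) := ⟨_, rfl⟩
  have hZ : ∀ p, Z p = gnCutoff ((π + z) ^ 2 / π ^ 2) ((π + z) ^ 2) (p 0 ^ 2) * gnCutoff ((π + z) ^ 2 / π ^ 2) ((π + z) ^ 2) (p 1 ^ 2) *
    ((radialCutoffC (1 / 2) (momToComplex p) * sectorWeightCirc na ((ωa : ℕ) : ℤ) (polarAngle p)) *
      (radialCutoffC (1 / 2) (momToComplex p) * sectorWeightCirc nb ((ωb : ℕ) : ℤ) (polarAngle p))) := fun p => by rw [hZdef]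
  obtain ⟨Φ, hΦdef⟩ : ∃ Φ : ℝ × (Fin 2 → ℝ) → ℂ, Φ = fun y => (((bgmCutoffSq e₀ ((16 : ℝ) ^ na * (y.1 ^ 2 + (frameLevel μ K (WithLp.toLp 2 y.2) - ν y.2) ^ 2)) -
      bgmCutoffSq e₀ ((16 : ℝ) ^ na * (y.1 ^ 2 + frameLevel μ K (WithLp.toLp 2 y.2) ^ 2))) *
      (bgmCutoffSq e₀ ((16 : ℝ) ^ nb * (y.1 ^ 2 + frameLevel μ K (WithLp.toLp 2 y.2) ^ 2)) * Z y.2) : ℝ) : ℂ) := ⟨_, rfl⟩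
  have hΦ : ∀ k₀ p, Φ (k₀, p) = (((bgmCutoffSq e₀ ((16 : ℝ) ^ na * (k₀ ^ 2 + (frameLevel μ K (WithLp.toLp 2 p) - ν p) ^ 2)) -
      bgmCutoffSq e₀ ((16 : ℝ) ^ na * (k₀ ^ 2 + frameLevel μ K (WithLp.toLp 2 p) ^ 2))) *
      (bgmCutoffSq e₀ ((16 : ℝ) ^ nb * (k₀ ^ 2 + frameLevel μ K (WithLp.toLp 2 p) ^ 2)) * Z p) : ℝ) : ℂ) := fun k₀ p => by rw [hΦdef]
  have hGsΦ : ∀ q, Gs q = Φ (π * (1 - 2 * M) / β + 2 * π / β * (((q.1 0).val : ℕ) : ℝ), fun j => 2 * π / L * (((q.2 j).valMinAbs : ℤ) : ℝ)) := by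
    intro q'; rw [hGsdef]
    exact klAnisoIncr_mul_klAniso_eq_symbol Ko hA he hz h3 ωa ωb hZ hν hΦ q'
  -- the step and its norms
  set w : Fin 2 → ℝ := fun j => 2 * π / L * (u j : ℝ) with hw
  set η : ℝ := ‖(WithLp.toLp 2 (fun j => 2 * π / L * (u j : ℝ)) : EuclideanSpace ℝ (Fin 2))‖ with hηdef
  have hη0 : 0 ≤ η := norm_nonneg _
  have hwη : ‖w‖ ≤ η := by
    rw [hηdef, norm_toLp_latticeStep]
    refine (pi_norm_le_iff_of_nonneg (by positivity)).2 fun i => ?_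
    rw [hw, Real.norm_eq_abs, abs_mul, abs_of_pos (by positivity : (0:ℝ) < 2 * π / L)]
    refine mul_le_mul_of_nonneg_left (Real.abs_le_sqrt ?_) (by positivity)
    fin_cases i
    · exact le_add_of_nonneg_right (sq_nonneg _)
    · exact le_add_of_nonneg_left (sq_nonneg _)
  have hmc : ‖momToComplex w‖ = η := by
    rw [hηdef, ← norm_momToComplex_ofLp]
  -- the cell of the co-factor around `p_F(θ_{n_b,ω_b})` at the co-factor's shell
  have hcellZ : ∀ p : Fin 2 → ℝ, (∀ i, |p i| ≤ π + z) → |frameLevel μ K (WithLp.toLp 2 p)| ≤ klScale e₀ nb → Z p ≠ 0 →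
      ‖p - klFermiPoint μ K (sectorCenter nb (ωb : ℕ))‖ ≤ ρf := by
    intro p hsq hshell hZne
    obtain ⟨-, hζb⟩ := angularFactor_support hZ hZne
    have h := frameBand_cell B hA hADt hz.le hz1 (by linarith only [hgap, hΛbe]) (by linarith only [hlo, hΛbe]) (by linarith only [hhi, hΛbe])
      nb (ωb : ℕ) hsq hshell hζb
    rw [hρf]; exact h
  -- the instance at the tangent step, exact brackets, anisotropic slot
  have hτ00 : 0 ≤ |2 * π / L| * T₀ := by positivity
  obtain ⟨h₁, h₂, h₃⟩ := norm_fwdDiff_iter_tangent_thinIncrPair_le hA hA3 he hz hz1 hgap h3 na nb hd1 hd2 hd3 hd4 hB0 hB hZ hνs hN₀ hN₁ hN₂ hN₃ hΦ hGsΦ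
    u hu hw hρf0 hτ00 hK₂ hvtan hcellZ rfl rfl rfl rfl rfl rfl rfl rfl rfl rfl rfl rfl rfl rfl rfl rfl rfl rfl rfl rfl rfl rfl rfl rfl rfl rfl rfl rfl rfl rfl rfl rfl q
  -- the anisotropic slot in scale form: `|2π/L|T₀ ≤ (T₀/(Nr−1))·η`
  have hηw : ‖(WithLp.toLp 2 w : EuclideanSpace ℝ (Fin 2))‖ = η := rfl
  have hηNr : 2 * π / L * (Nr - 1) ≤ η := by
    rw [hηdef, norm_toLp_latticeStep]; exact mul_le_mul_of_nonneg_left hvlen (by positivity)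
  have hslot : |2 * π / L| * T₀ + K₂ * (Real.sqrt 2 * ρf) * ‖(WithLp.toLp 2 w : EuclideanSpace ℝ (Fin 2))‖ ≤ t * η := by
    rw [hηw, ht, abs_of_pos (by positivity : (0:ℝ) < 2 * π / L)]
    have h1 : 2 * π / L * T₀ ≤ T₀ / (Nr - 1) * η := by
      have h := mul_le_mul_of_nonneg_left hηNr (by positivity : (0:ℝ) ≤ T₀ / (Nr - 1))
      have e : T₀ / (Nr - 1) * (2 * π / L * (Nr - 1)) = 2 * π / L * T₀ := by field_simp
      linarith only [h, e]
    have e : (T₀ / (Nr - 1) + K₂ * (Real.sqrt 2 * ρf)) * η = T₀ / (Nr - 1) * η + K₂ * (Real.sqrt 2 * ρf) * η := by ring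
    rw [e]; linarith only [h1]
  -- the co-factor jets in scale form
  have hζ0 : 0 ≤ ζ := by rw [hζ]; have := sectorWidth_pos na; have := sectorWidth_pos nb; positivity
  have hzDa : (1 + 6 * (sectorWidth na)⁻¹) * ‖momToComplex w‖ ≤ ζ * η := by
    rw [hmc, hζ]
    have h1 : 0 ≤ 1 + 6 * (sectorWidth nb)⁻¹ := by have := sectorWidth_pos nb; positivity
    exact mul_le_mul_of_nonneg_right (le_add_of_nonneg_right h1) hη0
  have hzDb : (1 + 6 * (sectorWidth nb)⁻¹) * ‖momToComplex w‖ ≤ ζ * η := by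
    rw [hmc, hζ]
    have h1 : 0 ≤ 1 + 6 * (sectorWidth na)⁻¹ := by have := sectorWidth_pos na; positivity
    exact mul_le_mul_of_nonneg_right (le_add_of_nonneg_left h1) hη0
  obtain ⟨hq₁', hq₂', hq₃', h𝔮₁0, h𝔮₂0, h𝔮₃₀0, h𝔮₃₁0⟩ := thinIncr_cofactor_scale_le (g₁ := d * e₀ ^ 2) (g₂ := d * e₀ ^ 4) (g₃ := d * e₀ ^ 6)
    (Λ := klScale e₀ nb) (Kp := 4 + 4 * A) (A₃ := A₃) (τw := |2 * π / L| * T₀ + K₂ * (Real.sqrt 2 * ρf) * ‖(WithLp.toLp 2 w : EuclideanSpace ℝ (Fin 2))‖)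
    (nw := ‖w‖)
    (zD₁ := (1 + 6 * (sectorWidth na)⁻¹) * ‖momToComplex w‖) (zD₂ := (1 + 6 * (sectorWidth nb)⁻¹) * ‖momToComplex w‖)
    (Ba := Ba) (t := t) (η := η) (ζ := ζ) (ε₃₀ := ε₃₀) (ε₃₁ := ε₃₁) (x := x)
    (by positivity) (by positivity) (by positivity) hΛb (by positivity) hB0 (by positivity) (norm_nonneg _)
    (by have := sectorWidth_pos na; positivity) (by have := sectorWidth_pos nb; positivity)
    (by rw [ht]; positivity) hζ0 hε₃₀ hε₃₁ hx
    hslot hwη hzDa hzDb hA₃x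
    rfl rfl rfl rfl rfl rfl h𝔮₁ h𝔮₂ h𝔮₃₀ h𝔮₃₁
  have ht0 : 0 ≤ t := by rw [ht]; positivity
  -- nonnegativity of the co-factor's actual jets
  have hq₁0 : 0 ≤ 2 * (d * e₀ ^ 2) * (|2 * π / L| * T₀ + K₂ * (Real.sqrt 2 * ρf) * ‖(WithLp.toLp 2 w : EuclideanSpace ℝ (Fin 2))‖) / klScale e₀ nb * 1 +
      1 * (6 * Ba * ((1 + 6 * (sectorWidth na)⁻¹) * ‖momToComplex w‖ + (1 + 6 * (sectorWidth nb)⁻¹) * ‖momToComplex w‖)) := by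
    have := sectorWidth_pos na; have := sectorWidth_pos nb; positivity
  have hq₂0 : 0 ≤ ((4 * (d * e₀ ^ 4) + 2 * (d * e₀ ^ 2)) * (|2 * π / L| * T₀ + K₂ * (Real.sqrt 2 * ρf) * ‖(WithLp.toLp 2 w : EuclideanSpace ℝ (Fin 2))‖) ^ 2 /
        klScale e₀ nb ^ 2 + 2 * (d * e₀ ^ 2) * ((4 + 4 * A) * ‖w‖ ^ 2) / klScale e₀ nb) * 1 +
      4 * (d * e₀ ^ 2) * (|2 * π / L| * T₀ + K₂ * (Real.sqrt 2 * ρf) * ‖(WithLp.toLp 2 w : EuclideanSpace ℝ (Fin 2))‖) / klScale e₀ nb *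
        (6 * Ba * ((1 + 6 * (sectorWidth na)⁻¹) * ‖momToComplex w‖ + (1 + 6 * (sectorWidth nb)⁻¹) * ‖momToComplex w‖)) +
      1 * (6 * Ba * (((1 + 6 * (sectorWidth na)⁻¹) * ‖momToComplex w‖) ^ 2 + ((1 + 6 * (sectorWidth nb)⁻¹) * ‖momToComplex w‖) ^ 2) +
        72 * Ba ^ 2 * (((1 + 6 * (sectorWidth na)⁻¹) * ‖momToComplex w‖) * ((1 + 6 * (sectorWidth nb)⁻¹) * ‖momToComplex w‖))) := by
    have := sectorWidth_pos na; have := sectorWidth_pos nb; positivity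
  -- the algebra
  have hκ0 : 0 ≤ κ := by rw [hκ]; positivity
  have hA30 : 0 ≤ A₃ := (norm_nonneg _).trans (hA3 0)
  obtain ⟨c₁, c₂, c₃, hnn⟩ := incrPair_space_rel_scale_le (Λ := klScale e₀ na) (E₀ := klScale e₀ na + G₀ / x ^ 2) (t := t) (ε₂ := ε₂) (ε₃₀ := ε₃₀) (ε₃₁ := ε₃₁)
    (G₀ := G₀) (G₁ := G₁) (G₂ := G₂) (G₃ := G₃) (η := η) (x := x) (κ := κ) (C₁ := d * e₀ ^ 2 / klScale e₀ na ^ 2)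
    (C₂ := d * e₀ ^ 4 / klScale e₀ na ^ 4) (C₃ := d * e₀ ^ 6 / klScale e₀ na ^ 6) (C₄ := d * e₀ ^ 8 / klScale e₀ na ^ 8)
    (E₁ := |2 * π / L| * T₀ + K₂ * (Real.sqrt 2 * ρf) * ‖(WithLp.toLp 2 w : EuclideanSpace ℝ (Fin 2))‖) (E₂ := (4 + 4 * A) * ‖w‖ ^ 2)
    (E₃ := (4 + 8 * A₃) * ‖w‖ ^ 3)
    (P₀ := G₀ / x ^ 2) (P₁ := G₁ / x * ‖w‖) (P₂ := G₂ * ‖w‖ ^ 2) (P₃ := G₃ * x * ‖w‖ ^ 3)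
    hΛ (le_add_of_nonneg_right (by positivity)) (by linarith only [hGΛ]) ht0 (by rw [hε₂]; positivity) hε₃₀ hε₃₁ hG₀ hG₁ hG₂ hG₃ hη0 hx hκ0 (by positivity)
    (by positivity) (by positivity) (by positivity) (by positivity) (by positivity) (by positivity)
    hslot
    (by rw [hε₂]; exact mul_le_mul_of_nonneg_left (pow_le_pow_left₀ (norm_nonneg _) hwη 2) (by positivity))
    (mul_le_mul hA₃x (pow_le_pow_left₀ (norm_nonneg _) hwη 3) (by positivity) (by positivity))
    rfl (mul_le_mul_of_nonneg_left hwη (by positivity)) (mul_le_mul_of_nonneg_left (pow_le_pow_left₀ (norm_nonneg _) hwη 2) hG₂)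
    (mul_le_mul_of_nonneg_left (pow_le_pow_left₀ (norm_nonneg _) hwη 3) (by positivity))
    (by rw [hκ]; field_simp) (by rw [hκ]; field_simp) (by rw [hκ]; field_simp)
    rfl rfl rfl rfl rfl rfl rfl rfl rfl rfl rfl h₁ h₂ h₃ hq₁0 hq₂0 hq₁' hq₂' hq₃' h𝔮₁0 h𝔮₂0 h𝔮₃₀0 h𝔮₃₁0
    hd₁ hw₁ hd₂ hw₂ hd₃₀ hd₃₁ hw₃₀ hw₃₁ ho₁₀ ho₁₁ ho₂₀ ho₂₁ ho₂₂ ho₃₀ ho₃₁ ho₃₂ ho₃₃ hR₁₀ hR₁₁ hR₂₀ hR₂₁ hR₂₂ hR₃₀ hR₃₁ hR₃₂ hR₃₃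
    hr₁₀ hr₁₁ hr₂₀ hr₂₁ hr₂₂ hr₃₀ hr₃₁ hr₃₂ hr₃₃
  rw [← hC₁, ← hB₀x] at c₁ c₂ c₃
  exact ⟨c₁, c₂, c₃, hnn⟩

end ThinTanScale

end Summit.HubbardSuperconductivity.HubbardSuperconductivity.Theorems.TorusFourierL2

end
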